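import Literature.AlgebraicGeometry.Resolution.BlowupsScaling
import Literature.AlgebraicGeometry.Resolution.BlowupsProperProofs
import Literature.AlgebraicGeometry.Resolution.BlowupsFlatBaseChange
import Literature.AlgebraicGeometry.Resolution.AffineBlowupIntegral
import Literature.AlgebraicGeometry.Resolution.LocalBlowup
import Mathlib.LinearAlgebra.Matrix.Adjugate
import Mathlib.LinearAlgebra.Dimension.Localization
import Mathlib.Algebra.Module.Torsion.Basic
import Mathlib.AlgebraicGeometry.Modules.Sheaf
import Mathlib.RingTheory.Flat.Localization
import HarnessLib

/-!
# The blow-up of a ring (scheme) at a module: Nash transform / universal flattening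

Topic: `Literature/AlgebraicGeometry/Resolution`. Definition request `defn-ModuleBlowup`
(consumer: route `SyzygyFlattening`, crux `Globalisation`, whose inline `chart` is the
normalised blow-up of the determinant ideal of a syzygy module).

O. Villamayor U., *On flattening of coherent sheaves and of projective morphisms*, J. Algebra
295 (2006) 119–140 (read: pp. 119–129):

> **§2 (p. 123).** For each finitely generated module `M` of generic rank `r` [over a domain `A`
> with quotient field `K`] the class `[[M]]_A = Im(⋀^r M → K = ⋀^r(M ⊗_A K))`. The
> identification of `⋀^r(M ⊗_A K)` with `K` is not canonical, so the image is well-defined up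
> to isomorphism [of fractional ideals: `J₁ = k · J₂`, `0 ≠ k ∈ K`, (2.0.1)].
> **2.8.** `M` is generically flat, of generic rank `r`, if `M ⊗_A Q(A)` is a free
> `Q(A)`-module of rank `r` [`Q(A)` the total quotient ring]. If `A` is a domain any module is
> generically flat.
> **Theorem 3.3.** Let `M` be a finitely generated `A`-module, generically flat of generic rank
> `r`. There is a blow-up `Spec(A) ← X` with the following (universal) property: (1)
> `π^*(M)/tor(π^*(M))` is a locally free sheaf of `𝒪_X`-modules of rank `r`. (2) For any
> morphism `Spec(A) ← Y` for which `γ^*(M)/tor(γ^*(M))` is a flat `𝒪_Y`-sheaf of local rank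
> `r`, there is a unique `β : Y → X` with `β · π = γ`. *Proof.* … we set `Spec(A) ← X` as the
> blow-up at the fractionary ideal `[[M]]` (at any representative). Recall here that isomorphic
> fractionary ideals define the same blow-up. … [before 3.3:] The blow-up, defined in this
> theorem, will be called **the blow-up of `A` at the module `M`**.
> **3.4.** … over each affine open, say `Spec(A)`, we blow up at some representative of `[[M]]`.
> Any representative defines the same morphism over `Spec(A)` … If `M` is a module of generic
> rank `r`, then `M/tor(M)` can be included in a free module of rank `r`, say `M/tor(M) ⊂ A^r`;
> and from the very definition, in terms of wedge products, one can easily check that **`[[M]]`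
> is the ideal spanned by the determinants of all `r × r` matrices with rows in `M/tor(M)`,
> viewed as `r`-tuples via the inclusion in `A^r`.**
> **4.1.** If `A` is a domain … if `M = J` is an ideal, the blow-up is the usual one.

This is Rossi's universal flattening / the Nash transform of `X` relative to a coherent sheaf
(A. Oneto, E. Zatini, *Remarks on Nash blowing-up*, 1991: closure of the section of
`Grass_r(M)` over the locally free locus); instances are the Nash blow-up (`M = Ω¹`), Yasuda's
F-blowups (`M = F^e_* 𝒪_X`, T. Yasuda, Amer. J. Math. 134 (2012), §2: "`FB_e(X)` is the
universal flattening of `𝒪_X^{1/q}`"; this tree's `FBlowup.lean`, rendered the same way through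
the Frobenius norm ideal) and ordinary blow-ups (`M` an ideal, 4.1).

## Rendering

Mathlib has no Grassmannians/Quot schemes and no torsion or exterior powers of `𝒪_X`-modules, so
— exactly as for `FBlowup.lean` — the notion is rendered through Villamayor's blow-up
description, with the representative of `[[M]]` attached to an inclusion `M/tor(M) ⊂ A^r`
(3.4) made explicit:

* `frameMatrix φ g` / `normIdeal φ` — for an `A`-linear `φ : M → A^r` (`Fin r → A`), the
  `r × r` matrix with rows `φ (g i)` and **the norm (determinant) ideal
  `[[M]]_φ = ⟨det (φ (g i) j)_{i,j} : g : Fin r → M⟩ ⊆ A`** (Villamayor 3.4);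
* `IsFraming φ` — **`φ` is a rank-`r` framing of `M`**: `ker φ` is torsion and `coker φ` is
  torsion (torsion = killed by a non-zero-divisor), i.e. `φ ⊗ Q(A) : M ⊗ Q(A) ≅ Q(A)^r`; so `M`
  is generically flat of generic rank `r` (2.8) and `φ` is an inclusion `M/tor(M) ⊂ A^r` as in
  3.4, `[[M]]_φ` a representative of `[[M]]_A`;
* `IsBlowupAtModule A M r π` — **`π : Y → Spec A` is a blow-up of `Spec A` at the module `M`**
  (of generic rank `r`): a blowing up (`IsBlowup`, universal property of Görtz–Wedhorn
  Def. 13.90, `Blowups.lean`) along the ideal sheaf of `[[M]]_φ` for some rank-`r` framing `φ`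
  (Villamayor Thm. 3.3 and its proof);
* `IsModuleBlowup M r π` — the target-local version for an `𝒪_X`-module `M`
  (`X.Modules`) on an integral scheme `X` (Villamayor 3.4: over each nonempty affine open `U`,
  `π` is a blow-up of `U ≅ Spec Γ(X, U)` at the `Γ(X, U)`-module `Γ(M, U)`), the pattern of
  `IsFBlowup`.

PROVED API: `det_mem_normIdeal`; `IsFraming.exists_det_mem_nonZeroDivisors` (some `r`-tuple
has regular determinant, so `[[M]]_φ` has "depth ≥ 1") and `IsFraming.normIdeal_ne_bot`;
`IsFraming.det_smul_frameMatrix_eq` / `det_mul_det_eq` and **`IsFraming.exists_mul_eq_mul`: two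
framings `φ, ψ` of the same module give isomorphic fractional ideals,
`f · [[M]]_ψ = g · [[M]]_φ` with `f, g` regular** (Villamayor (2.0.1) / Cor. 2.6, by the adjugate
identity `det(φx) · ψ(g) = φ(g) adj(φx) ψ(x)`); `isFraming_idealFraming` /
`normIdeal_idealFraming` (**an ideal containing a regular element is framed by its inclusion and
`[[I]] = I`**, 4.1); over a domain, **framings of rank `r` exist iff `Module.rank A M = r`** for
`M` finite (`IsFraming.rank_eq`, `exists_isFraming`; Mathlib's `Module.rank` over a domain is
the generic rank, `IsLocalizedModule.rank_eq`); `normIdeal_eq_span_of_span_eq_top` (**`[[M]]_φ`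
is spanned by the determinants of tuples of generators**, multilinearity; `normIdeal_fg`);
`normIdeal_eq_map_of_span_eq_top` (**base change `[[M ⊗ B]]_{φ'} = [[M]]_φ B`** for a compatible
`φ'`); `localizedFraming` with `normIdeal_localizedFraming` (**`[[S⁻¹M]] = S⁻¹[[M]]`**) and
`IsFraming.of_isLocalizedModule` / `IsFraming.localizedFraming` (**framings localise**);
`IsFraming.exists_det_valuation_le` / `exists_det_div_mem` (**the chart of `Bl_{[[M]]}(Spec A)`
selected by a valuation ring `O ⊇ A` has a determinant `det(φx)` of minimal value as
denominator: `det(φg)/det(φx) ∈ O` for all `g`** — the `chart` of route `SyzygyFlattening`);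
`IsBlowupAtModule.isBlowup` (**independence of the framing**, via `BlowupsScaling`),
`isBlowupAtModule_affineBlowup` / `exists_isBlowupAtModule` (existence: `Bl_{[[M]]_φ}(Spec A)`),
`IsBlowupAtModule.unique`, `.isIntegral`, `.isBirational`, `.isProper`,
`isBlowupAtModule_ideal_iff` (4.1: for an ideal it is the ordinary blow-up),
`IsBlowupAtModule.of_flat_of_compatible` / **`IsBlowupAtModule.of_isLocalizedModule` (the
blow-up at a module commutes with flat base change, in particular with localisation:
`Bl_M(Spec A) ×_{Spec A} Spec S⁻¹A` is the blow-up of `Spec S⁻¹A` at `S⁻¹M`)**;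
`IsModuleBlowup.isIntegral` / `.isProper` / `.isBirational`.

## What is NOT here

The flattening universal property Thm. 3.3 (1)–(2) itself (no torsion of `𝒪_X`-modules in
Mathlib) — `IsBlowupAtModule` is the blow-up CHARACTERISATION of the universal flattening, which
is how Villamayor constructs it; the exterior-power / Fitting-ideal description of `[[M]]`
(Prop. 2.5) and its invariance under adding free summands to `M`; the gluing of the affine
blow-ups to a global `X`-scheme and `IsModuleBlowup (M~) r (Bl(Spec A))` (3.4; pattern of
`BlowupsExistence.lean`, from `IsBlowupAtModule.of_isLocalizedModule`); the identification
of the valuation-selected chart ring `A[det(φg)/det(φx) : g]` with an `IsLocalBlowupAlong O`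
along `[[M]]_φ` (`LocalBlowup.lean`; only its denominator `exists_det_div_mem` is here); the
identification of `IsFBlowup` with `IsModuleBlowup` for `M = F^e_* 𝒪_X`.

## Sources

* O. Villamayor U., J. Algebra 295 (2006) 119–140: §2 (p. 123, (2.0.1)), Def. 2.8, Thm. 3.3,
  3.4, 3.5, 4.1 (pp. 122–129, read from the materialised text). [Villamayoru2006]
* A. Oneto, E. Zatini, *Remarks on Nash blowing-up*, Rend. Sem. Mat. Univ. Politec. Torino 49
  (1991) 71–82 (the Grassmannian description; cited after Yasuda 2012, §1). [OnetoZatini1991]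
* T. Yasuda, *Universal flattening of Frobenius*, Amer. J. Math. 134 (2012), §2.1 (Def. 2.2,
  Cor. 2.6 and the paragraph after it). [Yasuda2012]
* U. Görtz, T. Wedhorn, *Algebraic Geometry I*, Def. 13.90, Prop. 13.91 (2) (through
  `Blowups.lean`, `BlowupsFlatBaseChange.lean`). [GortzWedhorn2020]
* J. Novacoski, M. Spivakovsky, *Reduction of local uniformization to the rank one case*,
  Def. 2.11 (the chart of a generator of minimal value; through `LocalBlowup.lean`).
  [NovacoskiSpivakovsky2014]
-/

noncomputable section

open CategoryTheory CategoryTheory.Limits AlgebraicGeometry TopologicalSpace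
open scoped nonZeroDivisors

namespace Literature.AlgebraicGeometry.Resolution

universe u v w

/-! ## The norm (determinant) ideal of a framed module -/

section NormIdeal

variable {A : Type u} [CommRing A] {M : Type v} [AddCommGroup M] [Module A M] {r : ℕ}

/-- The `r × r` matrix whose `i`-th row is `φ (g i) ∈ A^r`. [cite: Villamayoru2006, 3.4] -/
def frameMatrix (φ : M →ₗ[A] (Fin r → A)) (g : Fin r → M) : Matrix (Fin r) (Fin r) A :=
  Matrix.of fun i j => φ (g i) j

/-- Entries of the frame matrix. [folklore] -/
@[simp]
theorem frameMatrix_apply (φ : M →ₗ[A] (Fin r → A)) (g : Fin r → M) (i j : Fin r) :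
    frameMatrix φ g i j = φ (g i) j :=
  rfl

/-- **The norm (determinant) ideal `[[M]]_φ` of `M` with respect to `φ : M → A^r`**: the ideal
spanned by the determinants of all `r × r` matrices with rows `φ (g 1), …, φ (g r)`, `g i ∈ M`
— Villamayor's description of the norm `[[M]]_A = Im(⋀^r M → ⋀^r (M ⊗ K) ≅ K)` of a module of
generic rank `r` through an inclusion `M/tor(M) ⊂ A^r` (for `φ` a framing, `IsFraming`).
[cite: Villamayoru2006, §2 p. 123 and 3.4 p. 128] -/
def normIdeal (φ : M →ₗ[A] (Fin r → A)) : Ideal A :=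
  Ideal.span (Set.range fun g : Fin r → M => (frameMatrix φ g).det)

/-- Unfolding of `normIdeal`. [cite: Villamayoru2006, 3.4] -/
theorem normIdeal_eq_span (φ : M →ₗ[A] (Fin r → A)) :
    normIdeal φ = Ideal.span (Set.range fun g : Fin r → M => (frameMatrix φ g).det) :=
  rfl

/-- The determinants `det (φ (g i) j)` lie in `[[M]]_φ`. [cite: Villamayoru2006, 3.4] -/
theorem det_mem_normIdeal (φ : M →ₗ[A] (Fin r → A)) (g : Fin r → M) :
    (frameMatrix φ g).det ∈ normIdeal φ :=
  Ideal.subset_span ⟨g, rfl⟩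

/-- **`φ : M → A^r` is a rank-`r` framing of `M`**: its kernel consists of torsion elements
(killed by a non-zero-divisor) and its cokernel is torsion (every `z ∈ A^r` has a regular
multiple in the image). Equivalently `φ ⊗_A Q(A) : M ⊗_A Q(A) → Q(A)^r` is an isomorphism
(`Q(A)` the total quotient ring), so that `M` is *generically flat of generic rank `r`*
(Villamayor Def. 2.8; automatic generic flatness over a domain) and `φ` induces the inclusion
`M/tor(M) ⊂ A^r` of Villamayor 3.4. [cite: Villamayoru2006, Def. 2.8 and 3.4] -/
structure IsFraming (φ : M →ₗ[A] (Fin r → A)) : Prop where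
  /-- the kernel is torsion -/
  exists_smul_eq_zero : ∀ m : M, φ m = 0 → ∃ a ∈ A⁰, a • m = 0
  /-- the cokernel is torsion -/
  exists_smul_mem : ∀ z : Fin r → A, ∃ a ∈ A⁰, a • z ∈ LinearMap.range φ

/-- Over a domain the framing conditions may be checked with nonzero multipliers. [folklore] -/
theorem IsFraming.of_ne_zero [IsDomain A] {φ : M →ₗ[A] (Fin r → A)}
    (h₁ : ∀ m : M, φ m = 0 → ∃ a : A, a ≠ 0 ∧ a • m = 0)
    (h₂ : ∀ z : Fin r → A, ∃ a : A, a ≠ 0 ∧ a • z ∈ LinearMap.range φ) : IsFraming φ where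
  exists_smul_eq_zero m hm := by
    obtain ⟨a, ha, h⟩ := h₁ m hm
    exact ⟨a, mem_nonZeroDivisors_of_ne_zero ha, h⟩
  exists_smul_mem z := by
    obtain ⟨a, ha, h⟩ := h₂ z
    exact ⟨a, mem_nonZeroDivisors_of_ne_zero ha, h⟩

/-- An injective `φ : M → A^r` with torsion cokernel (the shape of the syzygy embeddings of route
`SyzygyFlattening`) is a framing. [folklore] -/
theorem IsFraming.of_injective [IsDomain A] {φ : M →ₗ[A] (Fin r → A)}
    (h₁ : Function.Injective φ)
    (h₂ : ∀ z : Fin r → A, ∃ a : A, a ≠ 0 ∧ a • z ∈ LinearMap.range φ) : IsFraming φ :=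
  IsFraming.of_ne_zero (fun m hm => ⟨1, one_ne_zero, by
    rw [one_smul]; exact h₁ (hm.trans (map_zero φ).symm)⟩) h₂

/-- A regular scalar that kills a vector of `A^r` kills nothing: `b ∈ A⁰`, `b • v = 0 ⇒ v = 0`.
[folklore] -/
theorem eq_zero_of_smul_eq_zero_of_mem_nonZeroDivisors {ι : Type w} {b : A} (hb : b ∈ A⁰)
    {v : ι → A} (h : b • v = 0) : v = 0 := by
  funext k
  have hk := congr_fun h k
  rw [Pi.smul_apply, smul_eq_mul, Pi.zero_apply] at hk
  exact (mul_left_mem_nonZeroDivisors_eq_zero_iff hb).mp hk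

namespace IsFraming

variable {φ : M →ₗ[A] (Fin r → A)}

/-- **A framed module has an `r`-tuple with regular determinant**: lifting regular multiples
`a_j e_j` of the standard basis vectors through `φ` gives a diagonal matrix with determinant
`∏ a_j ∈ A⁰`. Hence `[[M]]_φ` meets `A⁰` ("`[[M]]` is generically flat of rank one",
Villamayor 2.8). [cite: Villamayoru2006, 2.8] -/
theorem exists_det_mem_nonZeroDivisors (h : IsFraming φ) :
    ∃ x : Fin r → M, (frameMatrix φ x).det ∈ A⁰ := by
  choose a ha hmem using fun j : Fin r => h.exists_smul_mem (Pi.single j 1)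
  choose x hx using fun j => LinearMap.mem_range.mp (hmem j)
  refine ⟨x, ?_⟩
  have hdiag : frameMatrix φ x = Matrix.diagonal a := by
    ext i j
    rw [frameMatrix_apply, hx i, Pi.smul_apply, Pi.single_apply, Matrix.diagonal_apply,
      smul_eq_mul, mul_ite, mul_one, mul_zero]
    simp only [eq_comm]
  rw [hdiag, Matrix.det_diagonal]
  exact prod_mem fun j _ => ha j

/-- The norm ideal of a framing contains a regular element. [cite: Villamayoru2006, 2.8] -/
theorem exists_mem_normIdeal_mem_nonZeroDivisors (h : IsFraming φ) :
    ∃ d ∈ normIdeal φ, d ∈ A⁰ := by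
  obtain ⟨x, hx⟩ := h.exists_det_mem_nonZeroDivisors
  exact ⟨_, det_mem_normIdeal φ x, hx⟩

/-- **The norm ideal of a framing is nonzero.** [cite: Villamayoru2006, 2.8] -/
theorem normIdeal_ne_bot [Nontrivial A] (h : IsFraming φ) : normIdeal φ ≠ ⊥ := by
  obtain ⟨d, hd, hd0⟩ := h.exists_mem_normIdeal_mem_nonZeroDivisors
  intro hbot
  rw [hbot, Ideal.mem_bot] at hd
  exact (nonZeroDivisors.ne_zero hd0) hd

/-- **The adjugate identity.** For a framing `φ`, any `ψ : M → A^r` and `r`-tuples `x, g` of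
elements of `M`: `det(φx) · ψ(g) = φ(g) · adj(φx) · ψ(x)` as `r × r` matrices (rows `ψ (g i)`,
`φ (g i)`, `ψ (x i)`). Indeed the elements `u_i = det(φx) g_i - Σ_j (φ(g) adj(φx))_{ij} x_j` lie
in `ker φ` (because `adj(φx) · φx = det(φx)`), hence are torsion, so `ψ(u_i)` is killed by a
regular scalar in the torsion-free `A^r`, i.e. vanishes (compare Villamayor's proof of
Prop. 2.2 / Cor. 2.6, which produces the comparison functional `γ`). [folklore] -/
theorem det_smul_frameMatrix_eq (h : IsFraming φ) (ψ : M →ₗ[A] (Fin r → A)) (x g : Fin r → M) :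
    (frameMatrix φ x).det • frameMatrix ψ g =
      frameMatrix φ g * (frameMatrix φ x).adjugate * frameMatrix ψ x := by
  set Φ := frameMatrix φ x with hΦ
  set P := frameMatrix φ g with hP
  set C := P * Φ.adjugate with hC
  have hCΦ : C * Φ = Φ.det • P := by
    rw [hC, Matrix.mul_assoc, Matrix.adjugate_mul, Matrix.mul_smul, Matrix.mul_one]
  -- the elements `u i` lie in the kernel of `φ`
  have hu : ∀ i, φ (Φ.det • g i - ∑ j, C i j • x j) = 0 := by
    intro i
    rw [map_sub, map_smul, map_sum]
    funext k
    have hk := congr_fun (congr_fun hCΦ i) k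
    rw [Matrix.mul_apply, Matrix.smul_apply, smul_eq_mul] at hk
    simp only [Pi.sub_apply, Pi.smul_apply, smul_eq_mul, Finset.sum_apply, map_smul,
      Pi.zero_apply]
    rw [sub_eq_zero]
    have hPik : P i k = φ (g i) k := rfl
    have hΦjk : ∀ j, Φ j k = φ (x j) k := fun j => rfl
    rw [hPik] at hk
    simp only [hΦjk] at hk
    exact hk.symm
  -- hence `ψ (u i) = 0`, i.e. `det Φ • ψ (g i) = ∑ j, C i j • ψ (x j)`
  have hψ : ∀ i, Φ.det • ψ (g i) = ∑ j, C i j • ψ (x j) := by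
    intro i
    obtain ⟨b, hb, hbu⟩ := h.exists_smul_eq_zero _ (hu i)
    have h0 : b • ψ (Φ.det • g i - ∑ j, C i j • x j) = 0 := by
      rw [← map_smul, hbu, map_zero]
    have h1 := eq_zero_of_smul_eq_zero_of_mem_nonZeroDivisors hb h0
    rw [map_sub, map_smul, map_sum, sub_eq_zero] at h1
    simpa only [map_smul] using h1
  ext i k
  have hik := congr_fun (hψ i) k
  simp only [Pi.smul_apply, smul_eq_mul, Finset.sum_apply] at hik
  rw [Matrix.smul_apply, smul_eq_mul, frameMatrix_apply, hik, Matrix.mul_apply]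
  rfl

/-- **Determinant exchange.** For a framing `φ`, any `ψ : M → A^r` and an `r`-tuple `x` with
`det(φx)` regular: `det(φx) · det(ψg) = det(ψx) · det(φg)` for every `r`-tuple `g` (take
determinants in the adjugate identity and cancel `det(φx)^{r-1}`).
[cite: Villamayoru2006, (2.0.1) and Cor. 2.6] -/
theorem det_mul_det_eq (h : IsFraming φ) (ψ : M →ₗ[A] (Fin r → A)) {x : Fin r → M}
    (hx : (frameMatrix φ x).det ∈ A⁰) (g : Fin r → M) :
    (frameMatrix φ x).det * (frameMatrix ψ g).det =
      (frameMatrix ψ x).det * (frameMatrix φ g).det := by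
  have h1 := congrArg Matrix.det (h.det_smul_frameMatrix_eq ψ x g)
  rw [Matrix.det_smul, Matrix.det_mul, Matrix.det_mul, Matrix.det_adjugate,
    Fintype.card_fin] at h1
  -- `a^r det(ψg) = det(φg) a^(r-1) det(ψx)`; cancel `a^(r-1)`
  rcases Nat.eq_zero_or_pos r with hr | hr
  · subst hr
    simp [Matrix.det_fin_zero]
  · have hpow : (frameMatrix φ x).det ^ (r - 1) ∈ A⁰ := pow_mem hx (r - 1)
    have h2 : (frameMatrix φ x).det ^ (r - 1) * ((frameMatrix φ x).det * (frameMatrix ψ g).det) =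
        (frameMatrix φ x).det ^ (r - 1) * ((frameMatrix ψ x).det * (frameMatrix φ g).det) := by
      calc (frameMatrix φ x).det ^ (r - 1) * ((frameMatrix φ x).det * (frameMatrix ψ g).det)
          = (frameMatrix φ x).det ^ r * (frameMatrix ψ g).det := by
            rw [← mul_assoc, ← pow_succ, Nat.sub_add_cancel hr]
        _ = (frameMatrix φ g).det * (frameMatrix φ x).det ^ (r - 1) * (frameMatrix ψ x).det := h1
        _ = (frameMatrix φ x).det ^ (r - 1) * ((frameMatrix ψ x).det * (frameMatrix φ g).det) := by
            ring
    exact (mul_cancel_left_mem_nonZeroDivisors hpow).mp h2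

/-- **Independence of the framing** (Villamayor: the class `[[M]]_A` is well defined up to
isomorphism of fractional ideals, (2.0.1) `J₁ ≅ J₂ ⇔ J₁ = k · J₂`, `0 ≠ k`; Cor. 2.6: two
choices give isomorphic fractional ideals). For two rank-`r` framings `φ, ψ` of the same module
there are regular `f, g ∈ A` with `f · det(ψt) = g · det(φt)` for all `r`-tuples `t`, hence
`(f) · [[M]]_ψ = (g) · [[M]]_φ`. [cite: Villamayoru2006, (2.0.1) and Cor. 2.6] -/
theorem exists_mul_eq_mul (hφ : IsFraming φ) {ψ : M →ₗ[A] (Fin r → A)} (hψ : IsFraming ψ) :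
    ∃ f ∈ A⁰, ∃ g ∈ A⁰, (∀ t : Fin r → M, f * (frameMatrix ψ t).det = g * (frameMatrix φ t).det) ∧
      Ideal.span {f} * normIdeal ψ = Ideal.span {g} * normIdeal φ := by
  obtain ⟨x, hx⟩ := hφ.exists_det_mem_nonZeroDivisors
  obtain ⟨y, hy⟩ := hψ.exists_det_mem_nonZeroDivisors
  have hid := hφ.det_mul_det_eq ψ hx
  -- `g = det(ψx)` is regular: `f · det(ψy) = g · det(φy)` with the left side regular
  have hg : (frameMatrix ψ x).det ∈ A⁰ := by
    have h1 : (frameMatrix ψ x).det * (frameMatrix φ y).det ∈ A⁰ := by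
      rw [← hid y]
      exact mul_mem hx hy
    exact (mul_mem_nonZeroDivisors.mp h1).1
  refine ⟨_, hx, _, hg, hid, ?_⟩
  have hfun : (fun t : Fin r → M => (frameMatrix φ x).det * (frameMatrix ψ t).det) =
      fun t => (frameMatrix ψ x).det * (frameMatrix φ t).det := funext hid
  rw [normIdeal, normIdeal, Ideal.span_mul_span', Ideal.span_mul_span', Set.singleton_mul,
    Set.singleton_mul, ← Set.range_comp, ← Set.range_comp]
  exact congrArg (fun s : (Fin r → M) → A => Ideal.span (Set.range s)) hfun

end IsFraming

/-! ### The ideal case: `[[I]] = I` -/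

/-- The inclusion of an ideal `I ⊆ A` into `A = A^1`. [folklore] -/
def idealFraming (I : Ideal A) : I →ₗ[A] (Fin 1 → A) :=
  (LinearMap.pi fun _ : Fin 1 => LinearMap.id (R := A) (M := A)) ∘ₗ I.subtype

/-- The ideal framing is the inclusion in each (the single) coordinate. [folklore] -/
@[simp]
theorem idealFraming_apply (I : Ideal A) (x : I) (j : Fin 1) : idealFraming I x j = x :=
  rfl

/-- **An ideal containing a regular element is framed (rank one) by its inclusion into `A`.**
[cite: Villamayoru2006, 2.8 and 4.1] -/
theorem isFraming_idealFraming {I : Ideal A} (hI : ∃ d ∈ I, d ∈ A⁰) :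
    IsFraming (idealFraming I) where
  exists_smul_eq_zero m hm := by
    refine ⟨1, one_mem _, ?_⟩
    have h0 : (m : A) = 0 := by simpa using congr_fun hm 0
    rw [one_smul]
    exact Subtype.ext h0
  exists_smul_mem z := by
    obtain ⟨d, hdI, hd⟩ := hI
    refine ⟨d, hd, LinearMap.mem_range.mpr ⟨⟨d * z 0, I.mul_mem_right _ hdI⟩, ?_⟩⟩
    funext j
    rw [idealFraming_apply, Pi.smul_apply, smul_eq_mul, Fin.fin_one_eq_zero j]

/-- **For an ideal, the norm ideal of its inclusion is the ideal itself**: the `1 × 1`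
determinants are the elements of `I` (Villamayor 4.1: "if `M = J` is an ideal, the blow-up is
the usual one"). [cite: Villamayoru2006, 4.1] -/
theorem normIdeal_idealFraming (I : Ideal A) : normIdeal (idealFraming I) = I := by
  have hdet : ∀ g : Fin 1 → I, (frameMatrix (idealFraming I) g).det = (g 0 : A) := fun g => by
    rw [Matrix.det_fin_one, frameMatrix_apply, idealFraming_apply]
  apply le_antisymm
  · rw [normIdeal, Ideal.span_le]
    rintro _ ⟨g, rfl⟩
    change (frameMatrix (idealFraming I) g).det ∈ I
    rw [hdet]
    exact (g 0).2
  · intro d hd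
    have : d = (frameMatrix (idealFraming I) fun _ => ⟨d, hd⟩).det := by rw [hdet]
    rw [this]
    exact det_mem_normIdeal _ _

end NormIdeal

/-! ## Framings and the generic rank (over a domain) -/

section Rank

variable {A : Type u} [CommRing A] [IsDomain A] {M : Type v} [AddCommGroup M] [Module A M]
  {r : ℕ}

/-- **A framed module has generic rank `r`: `Module.rank A M = r`.** (Over a domain Mathlib's
`Module.rank A M` is the dimension of `M ⊗_A K` over the fraction field,
`IsLocalizedModule.rank_eq`, i.e. Villamayor's generic rank.) Proof: `ker φ` is torsion, of
rank `0`; `M / ker φ ≅ range φ ⊆ A^r` has rank `≤ r`, and `≥ r` because it contains regular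
multiples `a_j e_j` of the standard basis vectors. [cite: Villamayoru2006, 1.1 and 2.8] -/
theorem IsFraming.rank_eq {φ : M →ₗ[A] (Fin r → A)} (h : IsFraming φ) : Module.rank A M = r := by
  have hker : Module.rank A (LinearMap.ker φ) = 0 := by
    rw [rank_eq_zero_iff]
    rintro ⟨m, hm⟩
    obtain ⟨a, ha, ham⟩ := h.exists_smul_eq_zero m hm
    exact ⟨a, nonZeroDivisors.ne_zero ha, Subtype.ext (by simpa using ham)⟩
  have h1 := rank_quotient_add_rank_of_isDomain (LinearMap.ker φ)
  rw [hker, add_zero] at h1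
  -- `rank (range φ) = r`
  have hrange : Module.rank A (LinearMap.range φ) = r := by
    apply le_antisymm
    · exact (Submodule.rank_le _).trans (rank_fin_fun r).le
    · choose a ha hmem using fun j : Fin r => h.exists_smul_mem (Pi.single j 1)
      let v : Fin r → LinearMap.range φ := fun j => ⟨a j • Pi.single j 1, hmem j⟩
      have hv : LinearIndependent A v := by
        rw [Fintype.linearIndependent_iff]
        intro c hc j
        have h0 : (∑ i, c i • v i : LinearMap.range φ).1 j = 0 := by rw [hc]; rfl
        have h2 : (∑ i, c i • v i : LinearMap.range φ).1 j = c j * a j := by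
          rw [Submodule.coe_sum, Finset.sum_apply]
          simp only [v, Submodule.coe_smul, Pi.smul_apply, smul_eq_mul, Pi.single_apply,
            mul_ite, mul_one, mul_zero, Finset.sum_ite_eq, Finset.mem_univ, if_true]
        rw [h2] at h0
        exact (mul_right_mem_nonZeroDivisors_eq_zero_iff (ha j)).mp h0
      exact natCast_le_rank_iff.mpr ⟨v, hv⟩
  -- transport along `M ⧸ ker φ ≃ range φ` (different universes: compare lifts)
  have h2 := φ.quotKerEquivRange.lift_rank_eq
  rw [h1, hrange, Cardinal.lift_natCast, Cardinal.lift_eq_nat_iff] at h2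
  exact h2

/-- **A finite module of generic rank `r` over a domain admits a rank-`r` framing** (Villamayor
3.4: "`M/tor(M)` can be included in a free module of rank `r`"): take a maximal linearly
independent family `x₁, …, x_r ∈ M`; every `m ∈ M` has a nonzero multiple in the free module
`F = Σ A xᵢ`, so by finiteness one `a ≠ 0` works for all `m`, and `m ↦ (coordinates of a m)` is a
framing. [cite: Villamayoru2006, 3.4] -/
theorem exists_isFraming [Module.Finite A M] (hr : Module.rank A M = r) :
    ∃ φ : M →ₗ[A] (Fin r → A), IsFraming φ := by
  classical
  obtain ⟨x, hx⟩ := exists_linearIndependent_of_le_rank (R := A) (M := M) hr.ge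
  set F : Submodule A M := Submodule.span A (Set.range x) with hF
  -- maximality: every element has a nonzero multiple in `F`
  have hmax : ∀ m : M, ∃ c : A, c ≠ 0 ∧ c • m ∈ F := by
    intro m
    by_contra hcon
    push Not at hcon
    have hli : LinearIndependent A (Fin.cons m x : Fin (r + 1) → M) := by
      refine LinearIndependent.finCons' m x hx fun c y hy hcy => ?_
      by_contra hc
      refine hcon c hc ?_
      have hcm : c • m = -y := eq_neg_of_add_eq_zero_left hcy
      rw [hcm]
      exact F.neg_mem hy
    have hle := natCast_le_rank_iff.mpr ⟨_, hli⟩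
    rw [hr] at hle
    norm_cast at hle
    omega
  -- one nonzero multiplier for the whole (finitely generated) module
  obtain ⟨a, ha0, haF⟩ : ∃ a : A, a ≠ 0 ∧ ∀ m : M, a • m ∈ F := by
    obtain ⟨s, hs⟩ := Module.Finite.fg_top (R := A) (M := M)
    choose c hc0 hcF using hmax
    refine ⟨∏ m ∈ s, c m, Finset.prod_ne_zero_iff.mpr fun m _ => hc0 m, fun m => ?_⟩
    have hm : m ∈ Submodule.span A (s : Set M) := by rw [hs]; exact Submodule.mem_top
    induction hm using Submodule.span_induction with
    | mem y hy =>
        rw [← Finset.mul_prod_erase s c (Finset.mem_coe.mp hy), mul_comm, mul_smul]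
        exact F.smul_mem _ (hcF y)
    | zero => rw [smul_zero]; exact F.zero_mem
    | add y z _ _ hy hz => rw [smul_add]; exact F.add_mem hy hz
    | smul b y _ hy => rw [smul_comm]; exact F.smul_mem b hy
  -- the framing: coordinates of `a • m` in the basis `x` of `F`
  let B : Module.Basis (Fin r) A F := Module.Basis.span hx
  let ι : M →ₗ[A] F := LinearMap.codRestrict F (a • LinearMap.id) fun m => haF m
  have hι : ∀ m : M, (ι m : M) = a • m := fun m => rfl
  refine ⟨B.equivFun.toLinearMap ∘ₗ ι, IsFraming.of_ne_zero ?_ ?_⟩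
  · intro m hm
    refine ⟨a, ha0, ?_⟩
    have h0 : ι m = 0 := by
      have : B.equivFun (ι m) = 0 := hm
      exact B.equivFun.map_eq_zero_iff.mp this
    rw [← hι m, h0, Submodule.coe_zero]
  · intro z
    refine ⟨a, ha0, LinearMap.mem_range.mpr ⟨(B.equivFun.symm z : F), ?_⟩⟩
    have h1 : ι (B.equivFun.symm z : F) = a • B.equivFun.symm z := by
      apply Subtype.ext
      rw [hι, Submodule.coe_smul]
    change B.equivFun (ι (B.equivFun.symm z : F)) = a • z
    rw [h1, LinearEquiv.map_smul, LinearEquiv.apply_symm_apply]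

/-- Hence over a domain **rank-`r` framings of a finite module exist iff its generic rank is `r`**.
[cite: Villamayoru2006, 2.8 and 3.4] -/
theorem exists_isFraming_iff [Module.Finite A M] :
    (∃ φ : M →ₗ[A] (Fin r → A), IsFraming φ) ↔ Module.rank A M = r :=
  ⟨fun ⟨_, hφ⟩ => hφ.rank_eq, exists_isFraming⟩

end Rank

/-! ## Generators and base change of the norm ideal -/

section BaseChange

variable {A : Type u} [CommRing A] {M : Type v} [AddCommGroup M] [Module A M] {r : ℕ}

/-- A multilinear map takes arguments drawn from the span of a set `S` into the span of its
values on tuples from `S` (expand each argument and use multilinearity). [folklore] -/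
theorem multilinearMap_apply_mem_span {ι : Type*} [Fintype ι] [DecidableEq ι] {N : Type*}
    [AddCommGroup N] [Module A N] {P : Type*} [AddCommGroup P] [Module A P]
    (F : MultilinearMap A (fun _ : ι => N) P) (S : Set N) {v : ι → N}
    (hv : ∀ i, v i ∈ Submodule.span A S) :
    F v ∈ Submodule.span A (Set.range fun s : ι → S => F fun i => (s i : N)) := by
  choose n c s hs using fun i => Submodule.mem_span_set'.mp (hv i)
  have hv' : v = fun i => ∑ j : Fin (n i), c i j • (s i j : N) := funext fun i => (hs i).symm
  rw [hv', MultilinearMap.map_sum F fun i j => c i j • (s i j : N)]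
  refine Submodule.sum_mem _ fun p _ => ?_
  have key : (F fun i => c i (p i) • (s i (p i) : N)) =
      (∏ i, c i (p i)) • F fun i => (s i (p i) : N) :=
    F.map_smul_univ (fun i => c i (p i)) fun i => (s i (p i) : N)
  rw [key]
  exact Submodule.smul_mem _ _ (Submodule.subset_span ⟨fun i => s i (p i), rfl⟩)

/-- The determinant of the frame matrix as a multilinear form in the `r`-tuple. [folklore] -/
def frameDet (φ : M →ₗ[A] (Fin r → A)) : MultilinearMap A (fun _ : Fin r => M) A :=
  (Matrix.detRowAlternating : ((Fin r → A) [⋀^Fin r]→ₗ[A] A)).toMultilinearMap.compLinearMap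
    fun _ => φ

/-- `frameDet φ g = det (frameMatrix φ g)`. [folklore] -/
@[simp]
theorem frameDet_apply (φ : M →ₗ[A] (Fin r → A)) (g : Fin r → M) :
    frameDet φ g = (frameMatrix φ g).det :=
  rfl

/-- **`[[M]]_φ` is spanned by the determinants of the `r`-tuples drawn from any set of
generators of `M`** (multilinearity of the determinant in the rows); in particular it is
computed by finitely many determinants when `M` is finitely generated (Villamayor 3.4: "this
one has the advantage of providing generators of the ideal `[[M]]`").
[cite: Villamayoru2006, 3.4] -/
theorem normIdeal_eq_span_of_span_eq_top (φ : M →ₗ[A] (Fin r → A)) {S : Set M}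
    (hS : Submodule.span A S = ⊤) :
    normIdeal φ =
      Ideal.span (Set.range fun s : Fin r → S => (frameMatrix φ fun i => (s i : M)).det) := by
  classical
  apply le_antisymm
  · rw [normIdeal, Ideal.span_le]
    rintro _ ⟨g, rfl⟩
    have hmem := multilinearMap_apply_mem_span (frameDet φ) S (v := g)
      (fun i => by rw [hS]; exact Submodule.mem_top)
    simp only [frameDet_apply] at hmem
    exact hmem
  · apply Ideal.span_mono
    rintro _ ⟨s, rfl⟩
    exact ⟨fun i => (s i : M), rfl⟩

/-- The norm ideal of a finitely generated module is finitely generated (no Noetherian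
hypothesis). [cite: Villamayoru2006, 3.4] -/
theorem normIdeal_fg [Module.Finite A M] (φ : M →ₗ[A] (Fin r → A)) : (normIdeal φ).FG := by
  obtain ⟨s, hs⟩ := Module.Finite.fg_top (R := A) (M := M)
  rw [normIdeal_eq_span_of_span_eq_top φ hs]
  haveI : Finite (s : Set M) := s.finite_toSet.to_subtype
  exact Submodule.fg_def.mpr ⟨_, Set.finite_range _, rfl⟩

variable {B : Type w} [CommRing B] [Algebra A B] {M' : Type*} [AddCommGroup M'] [Module A M']
  [Module B M']

/-- Frame matrices along a compatible pair `(f, φ')`: `φ' ∘ f = algebraMap ∘ φ` entrywise.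
[folklore] -/
theorem frameMatrix_comp_eq_map (f : M →ₗ[A] M') (φ : M →ₗ[A] (Fin r → A))
    (φ' : M' →ₗ[B] (Fin r → B)) (hφ' : ∀ m, φ' (f m) = algebraMap A B ∘ φ m) (g : Fin r → M) :
    frameMatrix φ' (f ∘ g) = (algebraMap A B).mapMatrix (frameMatrix φ g) := by
  ext i j
  rw [frameMatrix_apply, Function.comp_apply, hφ', RingHom.mapMatrix_apply, Matrix.map_apply,
    frameMatrix_apply, Function.comp_apply]

/-- Determinants along a compatible pair: `det(φ'(f ∘ g)) = algebraMap (det(φ g))`. [folklore] -/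
theorem det_frameMatrix_comp (f : M →ₗ[A] M') (φ : M →ₗ[A] (Fin r → A))
    (φ' : M' →ₗ[B] (Fin r → B)) (hφ' : ∀ m, φ' (f m) = algebraMap A B ∘ φ m) (g : Fin r → M) :
    (frameMatrix φ' (f ∘ g)).det = algebraMap A B (frameMatrix φ g).det := by
  rw [frameMatrix_comp_eq_map f φ φ' hφ' g, ← RingHom.map_det]

/-- **Base change of the norm ideal.** Let `f : M → M'` be `A`-linear into a `B`-module whose
image generates `M'` over `B` (e.g. `M' = B ⊗_A M`, or `M' = S⁻¹M` over `B = S⁻¹A`), and let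
`φ' : M' → B^r` be `B`-linear with `φ' ∘ f = φ ⊗ B`. Then `[[M']]_{φ'} = [[M]]_φ · B`
(Villamayor 3.4: the representatives patch; compatibility of Fitting-type ideals with base
change, 1.1). [cite: Villamayoru2006, 1.1 and 3.4] -/
theorem normIdeal_eq_map_of_span_eq_top (f : M →ₗ[A] M')
    (hf : Submodule.span B (Set.range f) = ⊤) (φ : M →ₗ[A] (Fin r → A))
    (φ' : M' →ₗ[B] (Fin r → B)) (hφ' : ∀ m, φ' (f m) = algebraMap A B ∘ φ m) :
    normIdeal φ' = (normIdeal φ).map (algebraMap A B) := by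
  apply le_antisymm
  · rw [normIdeal_eq_span_of_span_eq_top φ' hf, Ideal.span_le]
    rintro _ ⟨s, rfl⟩
    choose g hg using fun i => Set.mem_range.mp (s i).2
    have hs : (fun i => (s i : M')) = f ∘ g := funext fun i => (hg i).symm
    change (frameMatrix φ' fun i => (s i : M')).det ∈ (normIdeal φ).map (algebraMap A B)
    rw [hs, det_frameMatrix_comp f φ φ' hφ' g]
    exact Ideal.mem_map_of_mem _ (det_mem_normIdeal φ g)
  · rw [Ideal.map_le_iff_le_comap, normIdeal, Ideal.span_le]
    rintro _ ⟨g, rfl⟩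
    change (frameMatrix φ g).det ∈ (normIdeal φ').comap (algebraMap A B)
    rw [Ideal.mem_comap, ← det_frameMatrix_comp f φ φ' hφ' g]
    exact det_mem_normIdeal φ' _

end BaseChange

/-! ## Localisation of framings and norm ideals -/

section Localization

variable {A : Type u} [CommRing A] (S : Submonoid A) (B : Type w) [CommRing B] [Algebra A B]
  [IsLocalization S B] {M : Type v} [AddCommGroup M] [Module A M] {M' : Type*} [AddCommGroup M']
  [Module A M'] [Module B M'] [IsScalarTower A B M'] (f : M →ₗ[A] M') [IsLocalizedModule S f]
  {r : ℕ}

/-- On a module over the localisation `B = S⁻¹A`, multiplication by `s ∈ S` is invertible.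
[folklore] -/
theorem isUnit_algebraMap_end_of_isLocalization (N : Type*) [AddCommGroup N] [Module A N]
    [Module B N] [IsScalarTower A B N] (s : S) : IsUnit (algebraMap A (Module.End A N) s) := by
  obtain ⟨u, hu⟩ := IsLocalization.map_units B s
  have h1 : ∀ n : N, algebraMap A (Module.End A N) s n = (u : B) • n := fun n => by
    rw [Module.algebraMap_end_apply, hu, algebraMap_smul]
  refine (Module.End.isUnit_iff _).mpr ⟨fun x y hxy => ?_, fun y => ⟨((u⁻¹ : Bˣ) : B) • y, ?_⟩⟩
  · have h2 := congrArg (fun n : N => ((u⁻¹ : Bˣ) : B) • n) hxy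
    simpa only [h1, smul_smul, Units.inv_mul, one_smul] using h2
  · rw [h1, smul_smul, Units.mul_inv, one_smul]

/-- **The localised framing `φ_S : S⁻¹M → (S⁻¹A)^r`** of `φ : M → A^r`: the unique
`S⁻¹A`-linear map with `φ_S (m/1) = φ(m)/1`. [folklore] -/
def localizedFraming (φ : M →ₗ[A] (Fin r → A)) : M' →ₗ[B] (Fin r → B) :=
  (IsLocalizedModule.lift S f ((Algebra.linearMap A B).compLeft (Fin r) ∘ₗ φ)
    (isUnit_algebraMap_end_of_isLocalization S B (Fin r → B))).extendScalarsOfIsLocalization S B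

/-- `φ_S (f m) = algebraMap ∘ φ m`. [folklore] -/
theorem localizedFraming_apply (φ : M →ₗ[A] (Fin r → A)) (m : M) :
    localizedFraming S B f φ (f m) = algebraMap A B ∘ φ m :=
  IsLocalizedModule.lift_apply S f ((Algebra.linearMap A B).compLeft (Fin r) ∘ₗ φ)
    (isUnit_algebraMap_end_of_isLocalization S B (Fin r → B)) m

include S in
/-- The image of `M` generates `S⁻¹M` over `S⁻¹A`. [folklore] -/
theorem span_range_eq_top_of_isLocalizedModule : Submodule.span B (Set.range f) = ⊤ := by
  rw [← Set.image_univ]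
  exact span_eq_top_of_isLocalizedModule B S f Submodule.span_univ

/-- **Norm ideals localise: `[[S⁻¹M]]_{φ_S} = S⁻¹[[M]]_φ`** (Villamayor 3.4: "Any
representative defines the same morphism over `Spec(A)`, so it suffices to check that these
morphisms patch; and this follows from the definition of `[[M]]`").
[cite: Villamayoru2006, 3.4] -/
theorem normIdeal_localizedFraming (φ : M →ₗ[A] (Fin r → A)) :
    normIdeal (localizedFraming S B f φ) = (normIdeal φ).map (algebraMap A B) :=
  normIdeal_eq_map_of_span_eq_top f (span_range_eq_top_of_isLocalizedModule S B f) φ _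
    (localizedFraming_apply S B f φ)

include S in
/-- The localisation map sends regular elements of `A` to regular elements of `S⁻¹A`.
[folklore] -/
theorem algebraMap_mem_nonZeroDivisors_of_isLocalization {a : A} (ha : a ∈ A⁰) :
    algebraMap A B a ∈ B⁰ :=
  IsLocalization.nonZeroDivisors_le_comap S B ha

variable {B f} in
include S in
/-- **Framings localise**: if `φ` is a rank-`r` framing of `M` then any `S⁻¹A`-linear
`φ' : S⁻¹M → (S⁻¹A)^r` compatible with `φ` (e.g. `localizedFraming`) is a rank-`r` framing of
`S⁻¹M` (kernel: clear denominators and use that `ker φ` is torsion; cokernel: clear the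
denominators of `z ∈ (S⁻¹A)^r` and lift a regular multiple through `φ`).
[cite: Villamayoru2006, 3.1 and 3.4] -/
theorem IsFraming.of_isLocalizedModule {φ : M →ₗ[A] (Fin r → A)} (hφ : IsFraming φ)
    (φ' : M' →ₗ[B] (Fin r → B)) (hφ' : ∀ m, φ' (f m) = algebraMap A B ∘ φ m) : IsFraming φ' where
  exists_smul_eq_zero m' hm' := by
    obtain ⟨⟨m, s⟩, hms⟩ := IsLocalizedModule.surj S f m'
    -- `φ m` dies in `B^r`, hence is killed by some `t ∈ S` componentwise, so by their product
    have h1 : algebraMap A B ∘ φ m = 0 := by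
      rw [← hφ', ← hms, LinearMap.map_smul_of_tower, hm', smul_zero]
    choose t ht using fun j => (IsLocalization.map_eq_zero_iff S B (φ m j)).mp (congr_fun h1 j)
    have hT : φ ((∏ j, (t j : A)) • m) = 0 := by
      rw [map_smul]
      funext j
      rw [Pi.smul_apply, smul_eq_mul, Pi.zero_apply,
        ← Finset.mul_prod_erase Finset.univ (fun i => (t i : A)) (Finset.mem_univ j),
        mul_right_comm, ht j, zero_mul]
    obtain ⟨a, ha, ham⟩ := hφ.exists_smul_eq_zero _ hT
    refine ⟨algebraMap A B (a * (∏ j, (t j : A)) * s), ?_, ?_⟩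
    · rw [map_mul, map_mul]
      have hu : IsUnit (algebraMap A B (∏ j, (t j : A))) :=
        IsLocalization.map_units B ⟨∏ j, (t j : A), prod_mem fun j _ => (t j).2⟩
      exact mul_mem (mul_mem (algebraMap_mem_nonZeroDivisors_of_isLocalization S B ha)
        hu.mem_nonZeroDivisors) (IsLocalization.map_units B s).mem_nonZeroDivisors
    · have h2 : f ((a * ∏ j, (t j : A)) • m) = 0 := by rw [mul_smul, ham, map_zero]
      have hms' : (s : A) • m' = f m := hms
      rw [map_mul, mul_smul, algebraMap_smul B (s : A) m', hms', algebraMap_smul B, ← map_smul f,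
        h2]
  exists_smul_mem z' := by
    obtain ⟨s, hs⟩ := IsLocalization.exist_integer_multiples_of_finite S z'
    choose z hz using fun i => RingHom.mem_rangeS.mp (hs i)
    obtain ⟨a, ha, hmem⟩ := hφ.exists_smul_mem z
    obtain ⟨m, hm⟩ := LinearMap.mem_range.mp hmem
    refine ⟨algebraMap A B (a * s), ?_, LinearMap.mem_range.mpr ⟨f m, ?_⟩⟩
    · rw [map_mul]
      exact mul_mem (algebraMap_mem_nonZeroDivisors_of_isLocalization S B ha)
        (IsLocalization.map_units B s).mem_nonZeroDivisors
    rw [hφ', hm]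
    funext j
    rw [Function.comp_apply, Pi.smul_apply, Pi.smul_apply, smul_eq_mul, smul_eq_mul, map_mul,
      hz j, Algebra.smul_def, map_mul, mul_assoc]

/-- In particular **`localizedFraming` of a framing is a framing of `S⁻¹M`.**
[cite: Villamayoru2006, 3.1 and 3.4] -/
theorem IsFraming.localizedFraming {φ : M →ₗ[A] (Fin r → A)} (hφ : IsFraming φ) :
    IsFraming (localizedFraming S B f φ) :=
  hφ.of_isLocalizedModule S _ (localizedFraming_apply S B f φ)

end Localization

/-! ## The chart selected by a valuation: a determinant of minimal value -/

section ValuativeChart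

variable {A : Type u} [CommRing A] [IsDomain A] {M : Type v} [AddCommGroup M] [Module A M]
  {r : ℕ} {K : Type w} [Field K] [Algebra A K] (O : ValuationSubring K)

/-- **The affine chart of `Bl_{[[M]]}(Spec A)` containing the centre of a valuation has a
determinant as denominator.** Let `A ⊆ O ⊆ K` (`O` a valuation ring of the field `K`, `ν` its
valuation) and let `φ` be a framing of the finite `A`-module `M`. Then some `r`-tuple `x` has
`det(φx) ≠ 0` of minimal value: `ν(det(φg)) ≥ ν(det(φx))` for ALL `r`-tuples `g` (in Mathlib's
multiplicative notation `O.valuation (det φg) ≤ O.valuation (det φx)`). Indeed `[[M]]_φ` is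
spanned by the finitely many determinants of tuples of generators
(`normIdeal_eq_span_of_span_eq_top`), one of which has minimal value (`exists_max_valuation`,
the chart of the local blowing up along `[[M]]_φ`, `LocalBlowup.lean`), and `ν ≥ 0` on `A`.
This is the denominator `det(x)` of the `chart` of route `SyzygyFlattening`.
[cite: NovacoskiSpivakovsky2014, Def. 2.11] -/
theorem IsFraming.exists_det_valuation_le [Module.Finite A M]
    (hinj : Function.Injective (algebraMap A K)) (hAO : ∀ a : A, algebraMap A K a ∈ O)
    {φ : M →ₗ[A] (Fin r → A)} (hφ : IsFraming φ) :
    ∃ x : Fin r → M, (frameMatrix φ x).det ≠ 0 ∧ ∀ g : Fin r → M,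
      O.valuation (algebraMap A K (frameMatrix φ g).det) ≤
        O.valuation (algebraMap A K (frameMatrix φ x).det) := by
  classical
  obtain ⟨s, hs⟩ := Module.Finite.fg_top (R := A) (M := M)
  haveI : Fintype (s : Set M) := s.finite_toSet.fintype
  have hgen := normIdeal_eq_span_of_span_eq_top φ hs
  set D : (Fin r → (s : Set M)) → A := fun t => (frameMatrix φ fun i => (t i : M)).det with hD
  -- some generating determinant is nonzero, since `[[M]]_φ ≠ 0`
  have hne : ∃ t ∈ (Finset.univ : Finset (Fin r → (s : Set M))), algebraMap A K (D t) ≠ 0 := by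
    by_contra hcon
    push Not at hcon
    apply hφ.normIdeal_ne_bot
    rw [hgen, Ideal.span_eq_bot]
    rintro _ ⟨t, rfl⟩
    exact hinj (by rw [map_zero]; exact hcon t (Finset.mem_univ t))
  obtain ⟨t₀, -, ht₀, hmax⟩ :=
    exists_max_valuation O Finset.univ (fun t => algebraMap A K (D t)) hne
  refine ⟨fun i => (t₀ i : M), fun h0 => ht₀ ?_, fun g => ?_⟩
  · change algebraMap A K ((frameMatrix φ fun i => (t₀ i : M)).det) = 0
    rw [h0, map_zero]
  · -- `det(φg)` is an `A`-combination of the generating determinants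
    have hg : (frameMatrix φ g).det ∈ Submodule.span A (Set.range D) := by
      have := det_mem_normIdeal φ g
      rwa [hgen] at this
    obtain ⟨c, hc⟩ := (Submodule.mem_span_range_iff_exists_fun A).mp hg
    rw [← hc, map_sum]
    apply Valuation.map_sum_le
    intro t _
    rw [smul_eq_mul, map_mul, map_mul]
    calc O.valuation (algebraMap A K (c t)) * O.valuation (algebraMap A K (D t))
        ≤ 1 * O.valuation (algebraMap A K (D t₀)) :=
          mul_le_mul' ((O.valuation_le_one_iff _).mpr (hAO (c t))) (hmax t (Finset.mem_univ t))
      _ = O.valuation (algebraMap A K (D t₀)) := one_mul _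

/-- Hence, in the fraction notation of route `SyzygyFlattening`: **some `r`-tuple `x` has
`det(φx) ≠ 0` in `K` and `det(φg)/det(φx) ∈ O` for every `r`-tuple `g`** — the generators
`det(φg)/det(φx)` of the chart `A[[[M]]_φ / det(φx)]` of the blowing up along `[[M]]_φ` selected
by the valuation ring `O`. [cite: NovacoskiSpivakovsky2014, Def. 2.11] -/
theorem IsFraming.exists_det_div_mem [Module.Finite A M]
    (hinj : Function.Injective (algebraMap A K)) (hAO : ∀ a : A, algebraMap A K a ∈ O)
    {φ : M →ₗ[A] (Fin r → A)} (hφ : IsFraming φ) :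
    ∃ x : Fin r → M, algebraMap A K (frameMatrix φ x).det ≠ 0 ∧ ∀ g : Fin r → M,
      algebraMap A K (frameMatrix φ g).det / algebraMap A K (frameMatrix φ x).det ∈ O := by
  obtain ⟨x, hx0, hle⟩ := hφ.exists_det_valuation_le O hinj hAO
  have hx0' : algebraMap A K (frameMatrix φ x).det ≠ 0 := fun e =>
    hx0 (hinj (by rw [e, map_zero]))
  refine ⟨x, hx0', fun g => ?_⟩
  have hv0 : O.valuation (algebraMap A K (frameMatrix φ x).det) ≠ 0 := by simpa using hx0'
  rw [← O.valuation_le_one_iff, map_div₀, div_le_one₀ (pos_iff_ne_zero.mpr hv0)]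
  exact hle g

end ValuativeChart

/-! ## The blow-up of `Spec A` at a module -/

section Affine

variable (A : Type u) [CommRing A] (M : Type v) [AddCommGroup M] [Module A M] (r : ℕ)

/-- **`π : Y → Spec A` is a blow-up of `Spec A` at the module `M`** (of generic rank `r`;
Villamayor 2006, Thm. 3.3 and the sentence before it: "the blow-up of `A` at the module `M`" is
the blow-up of `Spec A` at the fractional ideal `[[M]]`, at any representative): `π` is a
blowing up (`IsBlowup`, the universal property of Görtz–Wedhorn Def. 13.90) of `Spec A` along
the ideal sheaf of the norm ideal `[[M]]_φ` of some rank-`r` framing `φ : M → A^r`. Over a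
domain the choice of `φ` is immaterial (`IsBlowupAtModule.isBlowup`); this is the universal
flattening of `M` (Thm. 3.3 (1)–(2)), e.g. the Nash blow-up for `M = Ω¹`, an F-blowup for
`M = F^e_* A`, the ordinary blow-up for `M` an ideal (`isBlowupAtModule_ideal_iff`).
[cite: Villamayoru2006, Thm. 3.3 and 3.4] -/
def IsBlowupAtModule {Y : Scheme.{u}} (π : Y ⟶ Spec (.of A)) : Prop :=
  ∃ φ : M →ₗ[A] (Fin r → A), IsFraming φ ∧ IsBlowup π (affineBlowup.idealSheaf (normIdeal φ))

variable {A M r}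

/-- **Existence: the blowing up `Bl_{[[M]]_φ}(Spec A) → Spec A` (`Proj` of the Rees algebra,
`AffineBlowup.lean`) is a blow-up of `Spec A` at `M`** for every framing `φ`.
[cite: Villamayoru2006, proof of Thm. 3.3] -/
theorem IsFraming.isBlowupAtModule_affineBlowup {φ : M →ₗ[A] (Fin r → A)} (hφ : IsFraming φ) :
    IsBlowupAtModule A M r (affineBlowup.π (normIdeal φ)) :=
  ⟨φ, hφ, affineBlowup.isBlowup _⟩

/-- **A finite module of generic rank `r` over a domain has a blow-up.**
[cite: Villamayoru2006, Thm. 3.3] -/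
theorem exists_isBlowupAtModule [IsDomain A] [Module.Finite A M] (hr : Module.rank A M = r) :
    ∃ (Y : Scheme.{u}) (π : Y ⟶ Spec (.of A)), IsBlowupAtModule A M r π := by
  obtain ⟨φ, hφ⟩ := exists_isFraming hr
  exact ⟨_, _, hφ.isBlowupAtModule_affineBlowup⟩

namespace IsBlowupAtModule

variable {Y : Scheme.{u}} {π : Y ⟶ Spec (.of A)}

/-- A module that is blown up has generic rank `r` (over a domain). [cite: Villamayoru2006, 2.8] -/
theorem rank_eq [IsDomain A] (h : IsBlowupAtModule A M r π) : Module.rank A M = r := by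
  obtain ⟨φ, hφ, -⟩ := h
  exact hφ.rank_eq

/-- **Independence of the representative** (Villamayor, proof of Thm. 3.3: "isomorphic
fractionary ideals define the same blow-up"): over a domain, a blow-up at `M` is a blowing up
along `[[M]]_ψ` for EVERY rank-`r` framing `ψ` (`IsFraming.exists_mul_eq_mul` and
`isBlowup_iff_of_span_singleton_mul_eq` of `BlowupsScaling.lean`).
[cite: Villamayoru2006, proof of Thm. 3.3 and 3.4] -/
theorem isBlowup [IsDomain A] (h : IsBlowupAtModule A M r π) {ψ : M →ₗ[A] (Fin r → A)}
    (hψ : IsFraming ψ) : IsBlowup π (affineBlowup.idealSheaf (normIdeal ψ)) := by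
  obtain ⟨φ, hφ, hb⟩ := h
  obtain ⟨f, hf, g, hg, -, hfg⟩ := hφ.exists_mul_eq_mul hψ
  exact (isBlowup_iff_of_span_singleton_mul_eq hφ.normIdeal_ne_bot (nonZeroDivisors.ne_zero hf)
    (nonZeroDivisors.ne_zero hg) hfg).mp hb

/-- Over a domain, `IsBlowupAtModule` may be tested on any given framing. [cite: Villamayoru2006,
proof of Thm. 3.3] -/
theorem _root_.Literature.AlgebraicGeometry.Resolution.IsFraming.isBlowupAtModule_iff
    [IsDomain A]
    {ψ : M →ₗ[A] (Fin r → A)} (hψ : IsFraming ψ) :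
    IsBlowupAtModule A M r π ↔ IsBlowup π (affineBlowup.idealSheaf (normIdeal ψ)) :=
  ⟨fun h => h.isBlowup hψ, fun h => ⟨ψ, hψ, h⟩⟩

/-- **Uniqueness**: two blow-ups of `Spec A` at `M` are isomorphic over `Spec A` (`A` a domain).
[cite: Villamayoru2006, Thm. 3.3] -/
theorem unique [IsDomain A] {Y' : Scheme.{u}} {π' : Y' ⟶ Spec (.of A)}
    (h : IsBlowupAtModule A M r π) (h' : IsBlowupAtModule A M r π') :
    ∃ e : Y ≅ Y', e.hom ≫ π' = π ∧ e.inv ≫ π = π' := by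
  obtain ⟨φ, hφ, hb⟩ := h
  exact hb.unique (h'.isBlowup hφ)

/-- **The blow-up of a domain at a module is an integral scheme** (a blowing up of the integral
`Spec A` along the nonzero `[[M]]_φ~`, Stacks 02ND). [cite: Villamayoru2006, 3.4] -/
theorem isIntegral [IsDomain A] (h : IsBlowupAtModule A M r π) : IsIntegral Y := by
  obtain ⟨φ, hφ, hb⟩ := h
  exact hb.isIntegral (affineBlowup.idealSheaf_ne_bot hφ.normIdeal_ne_bot)

/-- **The blow-up at a module is birational** (Villamayor 3.4: "induces an isomorphism over a
dense open set in `Spec(A)`"). [cite: Villamayoru2006, 3.4] -/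
theorem isBirational [IsDomain A] (h : IsBlowupAtModule A M r π) : IsBirational π := by
  obtain ⟨φ, hφ, hb⟩ := h
  exact hb.isBirational' (affineBlowup.idealSheaf_ne_bot hφ.normIdeal_ne_bot)

/-- **The blow-up of a Noetherian ring at a module is proper** ("projective", Villamayor p. 119;
blowing ups of Noetherian schemes are proper, Stacks 02NS). [cite: Villamayoru2006, Thm. 3.3] -/
theorem isProper [IsNoetherianRing A] (h : IsBlowupAtModule A M r π) : IsProper π := by
  obtain ⟨φ, -, hb⟩ := h
  exact hb.isProper

/-- Blow-ups at a module transport along isomorphisms of the source. [folklore] -/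
theorem iso_comp (h : IsBlowupAtModule A M r π) {Y' : Scheme.{u}} (e : Y' ≅ Y) :
    IsBlowupAtModule A M r (e.hom ≫ π) := by
  obtain ⟨φ, hφ, hb⟩ := h
  exact ⟨φ, hφ, hb.iso_comp e⟩

end IsBlowupAtModule

/-- **For a nonzero ideal of a domain, the blow-up at the module `I` is the ordinary blow-up
along `I`** (Villamayor 4.1: "if `M = J` is an ideal, the blow-up is the usual one"): `I ⊆ A`
is a rank-one framing with `[[I]] = I`. [cite: Villamayoru2006, 4.1] -/
theorem isBlowupAtModule_ideal_iff [IsDomain A] {I : Ideal A} (hI : I ≠ ⊥) {Y : Scheme.{u}}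
    (π : Y ⟶ Spec (.of A)) :
    IsBlowupAtModule A I 1 π ↔ IsBlowup π (affineBlowup.idealSheaf I) := by
  have hd : ∃ d ∈ I, d ∈ A⁰ := by
    obtain ⟨d, hdI, hd0⟩ := I.ne_bot_iff.mp hI
    exact ⟨d, hdI, mem_nonZeroDivisors_of_ne_zero hd0⟩
  rw [(isFraming_idealFraming hd).isBlowupAtModule_iff, normIdeal_idealFraming]

end Affine

/-! ### Flat base change and localisation of the blow-up at a module -/

section FlatBaseChange

variable {A : Type u} [CommRing A] {B : Type u} [CommRing B] [Algebra A B]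

/-- **Flat base change of a blowing up of `Spec A` along `Ĩ` is a blowing up of `Spec B` along
`(I B)~`** (`B` a flat `A`-algebra; blow-ups commute with flat base change, Görtz–Wedhorn
Prop. 13.91 (2) = `IsBlowup.pullback_snd_of_flat`, and `(Spec B → Spec A)⁻¹ Ĩ = (I B)~`,
`comap_ofIdealTop_SpecMap`). [cite: GortzWedhorn2020, Prop. 13.91 (2)] -/
theorem IsBlowup.pullback_snd_SpecMap_of_flat [Module.Flat A B] {I : Ideal A} {Y : Scheme.{u}}
    {π : Y ⟶ Spec (.of A)} (hb : IsBlowup π (affineBlowup.idealSheaf I)) :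
    IsBlowup (pullback.snd π (Spec.map (CommRingCat.ofHom (algebraMap A B))))
      (affineBlowup.idealSheaf (I.map (algebraMap A B))) := by
  haveI : Flat (Spec.map (CommRingCat.ofHom (algebraMap A B))) :=
    Flat.SpecMap_iff.mpr (RingHom.flat_algebraMap_iff.mpr ‹_›)
  have h1 := hb.pullback_snd_of_flat (Spec.map (CommRingCat.ofHom (algebraMap A B)))
  rwa [affineBlowup.idealSheaf, comap_ofIdealTop_SpecMap] at h1

variable {M : Type v} [AddCommGroup M] [Module A M] {M' : Type w} [AddCommGroup M'] [Module A M']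
  [Module B M'] {r : ℕ} {Y : Scheme.{u}} {π : Y ⟶ Spec (.of A)}

/-- **Blow-ups at a module commute with flat base change** (Villamayor 3.4; the blow-up form of
the base-change property of the universal flattening): if `π` is a blowing up of `Spec A`
along `[[M]]_φ~`, `B` is a flat `A`-algebra, `f : M → M'` generates the `B`-module `M'` and
`φ' : M' → B^r` is a framing of `M'` compatible with `φ`, then `π ×_{Spec A} Spec B → Spec B`
is a blow-up of `Spec B` at `M'` (it is a blowing up along `([[M]]_φ B)~ = [[M']]_{φ'}~`).
[cite: Villamayoru2006, 3.4] -/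
theorem IsBlowupAtModule.of_flat_of_compatible [Module.Flat A B] (f : M →ₗ[A] M')
    (hf : Submodule.span B (Set.range f) = ⊤) {φ : M →ₗ[A] (Fin r → A)}
    (hb : IsBlowup π (affineBlowup.idealSheaf (normIdeal φ))) {φ' : M' →ₗ[B] (Fin r → B)}
    (hφ' : IsFraming φ') (hcompat : ∀ m, φ' (f m) = algebraMap A B ∘ φ m) :
    IsBlowupAtModule B M' r (pullback.snd π (Spec.map (CommRingCat.ofHom (algebraMap A B)))) := by
  refine ⟨φ', hφ', ?_⟩
  rw [normIdeal_eq_map_of_span_eq_top f hf φ φ' hcompat]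
  exact hb.pullback_snd_SpecMap_of_flat

/-- **The blow-up at a module localises**: if `π : Y → Spec A` is a blow-up of `Spec A` at `M`
and `B = S⁻¹A`, `M' = S⁻¹M`, then `Y ×_{Spec A} Spec S⁻¹A → Spec S⁻¹A` is a blow-up of
`Spec S⁻¹A` at `S⁻¹M` (the framing `φ_S`, `[[S⁻¹M]]_{φ_S} = S⁻¹[[M]]_φ`, and flat base change
of blowing ups). In particular (`S = {fⁿ}`) the blow-up at `M` restricts over `D(f)` to the
blow-up at `M_f` — Villamayor 3.4: the local blow-ups patch. [cite: Villamayoru2006, 3.4] -/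
theorem IsBlowupAtModule.of_isLocalizedModule (S : Submonoid A) [IsLocalization S B]
    [IsScalarTower A B M'] (f : M →ₗ[A] M') [IsLocalizedModule S f]
    (h : IsBlowupAtModule A M r π) :
    IsBlowupAtModule B M' r (pullback.snd π (Spec.map (CommRingCat.ofHom (algebraMap A B)))) := by
  obtain ⟨φ, hφ, hb⟩ := h
  haveI : Module.Flat A B := IsLocalization.flat B S
  exact IsBlowupAtModule.of_flat_of_compatible f (span_range_eq_top_of_isLocalizedModule S B f) hb
    (hφ.localizedFraming S B f) (localizedFraming_apply S B f φ)

end FlatBaseChange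

/-! ## The blow-up of a scheme at an `𝒪_X`-module (target-local form) -/

section Global

variable {Y X : Scheme.{u}}

/-- **`π : Y → X` is a blow-up of the scheme `X` at the `𝒪_X`-module `M`** (of generic rank
`r`; Villamayor 2006, 3.4: "The universal property … allows us to extend it to the non-affine
case, replacing `M` by a coherent generically flat sheaf `𝓜`, of a fixed rank `r`, over a scheme
… over each affine open, say `Spec(A)`, we blow up at some representative of `[[M]]`. Any
representative defines the same morphism over `Spec(A)`, so it suffices to check that these
morphisms patch"): over every nonempty affine open `U ⊆ X`, the restriction of `π` over `U`,
read through `U ≅ Spec Γ(X, U)`, is a blow-up of `Spec Γ(X, U)` at the `Γ(X, U)`-module of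
sections `Γ(M, U)` (`IsBlowupAtModule`). Intended for `X` integral and `M` quasi-coherent of
finite type (then `Γ(M, U)~ = M|_U`, and the condition holds on EVERY affine open as soon as it
holds on an affine cover: norm ideals localise, `normIdeal_localizedFraming`, the framing is
immaterial over a domain, `IsBlowupAtModule.isBlowup`, and being a blowing up is local on the
base, `IsBlowup.of_openCover`); this is the Nash transform of `X` relative to `M`
(Oneto–Zatini), e.g. Yasuda's `FB_e(X)` for `M = F^e_* 𝒪_X` (compare `IsFBlowup`).
[cite: Villamayoru2006, Thm. 3.3 and 3.4] -/
structure IsModuleBlowup (M : X.Modules) (r : ℕ) (π : Y ⟶ X) : Prop where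
  /-- over each nonempty affine open `U`, `π` is a blow-up of `U` at `Γ(M, U)` -/
  isBlowupAtModule_restrict : ∀ (U : X.affineOpens) [Nonempty (U : X.Opens)],
    IsBlowupAtModule Γ(X, U) Γ(M, (U : X.Opens)) r (π ∣_ (U : X.Opens) ≫ U.2.isoSpec.hom)

namespace IsModuleBlowup

/-- Affine opens exist around every point of a scheme. [folklore] -/
theorem exists_affineOpens_mem (x : X) : ∃ U : X.affineOpens, x ∈ (U : X.Opens) := by
  obtain ⟨W, hW, hxW, -⟩ :=
    exists_isAffineOpen_mem_and_subset (X := X) (x := x) (U := ⊤) (Opens.mem_top x)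
  exact ⟨⟨W, hW⟩, hxW⟩

variable {M : X.Modules} {r : ℕ} {π : Y ⟶ X}

/-- Over a nonempty affine open of an integral scheme, a blow-up at `M` is a blowing up along a
NONZERO ideal sheaf (the norm ideal of a framing of `Γ(M, U)` over the domain `Γ(X, U)`).
[cite: Villamayoru2006, 3.4] -/
theorem exists_isBlowup_ne_bot [IsIntegral X] (h : IsModuleBlowup M r π)
    (U : X.affineOpens) [Nonempty (U : X.Opens)] :
    ∃ I : Ideal Γ(X, U), affineBlowup.idealSheaf I ≠ ⊥ ∧
      IsBlowup (π ∣_ (U : X.Opens) ≫ U.2.isoSpec.hom) (affineBlowup.idealSheaf I) := by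
  obtain ⟨φ, hφ, hb⟩ := h.isBlowupAtModule_restrict U
  exact ⟨_, affineBlowup.idealSheaf_ne_bot hφ.normIdeal_ne_bot, hb⟩

/-- The module blown up has generic rank `r` on every nonempty affine open (`X` integral).
[cite: Villamayoru2006, 3.1] -/
theorem rank_eq [IsIntegral X] (h : IsModuleBlowup M r π) (U : X.affineOpens)
    [Nonempty (U : X.Opens)] : Module.rank Γ(X, U) Γ(M, (U : X.Opens)) = r :=
  (h.isBlowupAtModule_restrict U).rank_eq

/-- **Each chart `π⁻¹(U)` of a blow-up at a module is an integral scheme** (`X` integral, `U`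
nonempty affine; Stacks 02ND via `IsBlowup.isIntegral`). [cite: StacksProject, Tag 02ND] -/
theorem isIntegral_preimage [IsIntegral X] (h : IsModuleBlowup M r π) (U : X.affineOpens)
    [Nonempty (U : X.Opens)] : IsIntegral (π ⁻¹ᵁ (U : X.Opens) : Scheme.{u}) := by
  obtain ⟨I, hI, hb⟩ := h.exists_isBlowup_ne_bot U
  exact hb.isIntegral hI

/-- The underlying set of a chart `π⁻¹(U)` (`U` nonempty affine) is irreducible. [folklore] -/
theorem isIrreducible_preimage [IsIntegral X] (h : IsModuleBlowup M r π)
    (U : X.affineOpens) [Nonempty (U : X.Opens)] :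
    IsIrreducible ((π ⁻¹ᵁ (U : X.Opens) : Y.Opens) : Set Y) := by
  haveI := h.isIntegral_preimage U
  have : ((π ⁻¹ᵁ (U : X.Opens) : Y.Opens) : Set Y) = (π ⁻¹ᵁ (U : X.Opens)).ι '' Set.univ := by
    rw [Set.image_univ, Scheme.Opens.range_ι]
  rw [this]
  exact (IrreducibleSpace.isIrreducible_univ _).image _ (Scheme.Hom.continuous _).continuousOn

/-- **The source of a blow-up of an integral scheme at a module is integral**: reduced because
every stalk is a stalk of one of the integral charts `π⁻¹(U)`; irreducible because the charts are
irreducible opens any two of which contain a third (the chart of an affine open inside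
`U₁ ∩ U₂ ≠ ∅`). (The argument of `IsFBlowup.isIntegral`.) [cite: Villamayoru2006, 3.4] -/
theorem isIntegral [IsIntegral X] (h : IsModuleBlowup M r π) : IsIntegral Y := by
  have hchart : ∀ y : Y, ∃ U : X.affineOpens, π y ∈ (U : X.Opens) := fun y =>
    exists_affineOpens_mem (π y)
  -- reduced
  haveI : IsReduced Y := by
    haveI : ∀ y : Y, _root_.IsReduced (Y.presheaf.stalk y) := fun y => by
      obtain ⟨U, hyU⟩ := hchart y
      haveI : Nonempty (U : X.Opens) := ⟨⟨π y, hyU⟩⟩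
      haveI := h.isIntegral_preimage U
      let V : Y.Opens := π ⁻¹ᵁ (U : X.Opens)
      let y' : V := ⟨y, hyU⟩
      let i := (V.stalkIso y').commRingCatIsoToRingEquiv
      exact isReduced_of_injective i.symm.toRingHom i.symm.injective
    exact isReduced_of_isReduced_stalk Y
  -- irreducible
  haveI : IrreducibleSpace Y := by
    obtain ⟨x⟩ := (inferInstance : Nonempty X)
    obtain ⟨U₀, hxU₀⟩ := exists_affineOpens_mem x
    haveI : Nonempty (U₀ : X.Opens) := ⟨⟨x, hxU₀⟩⟩
    haveI := h.isIntegral_preimage U₀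
    obtain ⟨y₀⟩ := (inferInstance : Nonempty (π ⁻¹ᵁ (U₀ : X.Opens) : Scheme.{u}))
    haveI : Nonempty Y := ⟨y₀.1⟩
    haveI : PreirreducibleSpace Y := by
      refine ⟨fun u v hu hv hu' hv' => ?_⟩
      obtain ⟨y₁, -, hy₁⟩ := hu'
      obtain ⟨y₂, -, hy₂⟩ := hv'
      obtain ⟨U₁, h₁⟩ := hchart y₁
      obtain ⟨U₂, h₂⟩ := hchart y₂
      haveI : Nonempty (U₁ : X.Opens) := ⟨⟨π y₁, h₁⟩⟩
      haveI : Nonempty (U₂ : X.Opens) := ⟨⟨π y₂, h₂⟩⟩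
      obtain ⟨x₃, hx₃⟩ := nonempty_preirreducible_inter (U₁ : X.Opens).2 (U₂ : X.Opens).2
        ⟨π y₁, h₁⟩ ⟨π y₂, h₂⟩
      obtain ⟨W, hW, hxW, hWle⟩ := exists_isAffineOpen_mem_and_subset (X := X) (x := x₃)
        (U := (U₁ : X.Opens) ⊓ (U₂ : X.Opens)) hx₃
      let U₃ : X.affineOpens := ⟨W, hW⟩
      haveI : Nonempty (U₃ : X.Opens) := ⟨⟨x₃, hxW⟩⟩
      have hV₁ := (h.isIrreducible_preimage U₁).isPreirreducible
      have hV₂ := (h.isIrreducible_preimage U₂).isPreirreducible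
      have hV₃ := (h.isIrreducible_preimage U₃).nonempty
      have h31 : ((π ⁻¹ᵁ (U₃ : X.Opens) : Y.Opens) : Set Y) ⊆ (π ⁻¹ᵁ (U₁ : X.Opens) : Y.Opens) :=
        fun z hz => (hWle hz).1
      have h32 : ((π ⁻¹ᵁ (U₃ : X.Opens) : Y.Opens) : Set Y) ⊆ (π ⁻¹ᵁ (U₂ : X.Opens) : Y.Opens) :=
        fun z hz => (hWle hz).2
      obtain ⟨z, -, hzu, hz₃⟩ := hV₁ u _ hu (π ⁻¹ᵁ (U₃ : X.Opens)).2 ⟨y₁, h₁, hy₁⟩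
        (by obtain ⟨w, hw⟩ := hV₃; exact ⟨w, h31 hw, hw⟩)
      obtain ⟨t, -, ⟨htu, -⟩, htv⟩ := hV₂ _ v (hu.inter (π ⁻¹ᵁ (U₃ : X.Opens)).2) hv
        ⟨z, h32 hz₃, hzu, hz₃⟩ ⟨y₂, h₂, hy₂⟩
      exact ⟨t, Set.mem_univ t, htu, htv⟩
    exact ⟨inferInstance⟩
  exact isIntegral_of_irreducibleSpace_of_isReduced Y

/-- **A blow-up of a locally Noetherian scheme at a module is proper** (Villamayor: a blow-up;
properness is local on the base and blowing ups of Noetherian affine schemes are proper,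
Stacks 02NS = `IsBlowup.isProper`). [cite: Villamayoru2006, Thm. 3.3 and 3.4] -/
theorem isProper [IsLocallyNoetherian X] (h : IsModuleBlowup M r π) : IsProper π := by
  refine IsZariskiLocalAtTarget.of_iSup_eq_top (P := @IsProper)
    (fun U : {U : X.affineOpens // Nonempty (U : X.Opens)} => (U.1 : X.Opens)) ?_ fun U => ?_
  · rw [eq_top_iff]
    rintro x -
    obtain ⟨U, hxU⟩ := exists_affineOpens_mem x
    exact Opens.mem_iSup.mpr ⟨⟨U, ⟨⟨x, hxU⟩⟩⟩, hxU⟩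
  · obtain ⟨U, hU⟩ := U
    obtain ⟨φ, -, hb⟩ := h.isBlowupAtModule_restrict U
    haveI : IsNoetherianRing Γ(X, U) := IsLocallyNoetherian.component_noetherian U
    have h1 : IsProper (π ∣_ (U : X.Opens) ≫ U.2.isoSpec.hom) := hb.isProper
    exact (MorphismProperty.cancel_right_of_respectsIso @IsProper _ _).mp h1

/-- **A blow-up of an integral scheme at a module is birational** (Villamayor 3.4): over a
nonempty affine chart `U ≅ Spec Γ(X, U)` it is a blowing up along a nonzero ideal sheaf, hence
an isomorphism over the nonempty open complement `O` of the centre (`IsBlowup.isIso_compl`,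
Stacks 02OS); `O` is dense in the irreducible `X` and `π⁻¹(O) ≅ O` is dense in the irreducible
`Y`. (The argument of `IsFBlowup.isBirational`.) [cite: Villamayoru2006, 3.4] -/
theorem isBirational [IsIntegral X] (h : IsModuleBlowup M r π) : IsBirational π := by
  haveI := h.isIntegral
  obtain ⟨x⟩ := (inferInstance : Nonempty X)
  obtain ⟨U, hxU⟩ := exists_affineOpens_mem x
  haveI : Nonempty (U : X.Opens) := ⟨⟨x, hxU⟩⟩
  obtain ⟨I, hJ, hb⟩ := h.exists_isBlowup_ne_bot U
  -- `π ∣_ U` is a blowing up of `U` along `Ĩ` moved to `U`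
  have hb' : IsBlowup (π ∣_ (U : X.Opens))
      ((affineBlowup.idealSheaf I).comap U.2.isoSpec.hom) := by
    have := hb.comp_iso U.2.isoSpec.symm
    rwa [Iso.symm_hom, Iso.symm_inv, Category.assoc, Iso.hom_inv_id, Category.comp_id] at this
  -- hence an isomorphism over the complement `W` of the centre, a nonempty open of `U`
  have h2 : IsIso (π ∣_ (U : X.Opens) ∣_
      centreCompl ((affineBlowup.idealSheaf I).comap U.2.isoSpec.hom)) := hb'.isIso_compl
  have h3 : IsIso (π ∣_ ((U : X.Opens).ι ''ᵁ
      centreCompl ((affineBlowup.idealSheaf I).comap U.2.isoSpec.hom))) :=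
    ((MorphismProperty.isomorphisms Scheme).arrow_mk_iso_iff
      (morphismRestrictRestrict π (U : X.Opens) _)).mp h2
  have hWne : ((centreCompl ((affineBlowup.idealSheaf I).comap U.2.isoSpec.hom) :
      (U : X.Opens).toScheme.Opens) : Set (U : X.Opens)).Nonempty := by
    obtain ⟨s, hs⟩ := centreCompl_nonempty hJ
    refine ⟨U.2.isoSpec.inv s, ?_⟩
    have hs' : s ∉ ((affineBlowup.idealSheaf I).support : Set (Spec Γ(X, U))) := hs
    have heq : U.2.isoSpec.hom (U.2.isoSpec.inv s) = s :=
      U.2.isoSpec.schemeIsoToHomeo.apply_symm_apply s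
    change U.2.isoSpec.inv s ∉
      ((((affineBlowup.idealSheaf I).comap U.2.isoSpec.hom)).support : Set (U : X.Opens))
    rw [Scheme.IdealSheafData.support_comap]
    change ¬ (U.2.isoSpec.hom (U.2.isoSpec.inv s) ∈
      ((affineBlowup.idealSheaf I).support : Set (Spec Γ(X, U))))
    rwa [heq]
  -- the corresponding open `O = U.ι '' W` of `X` is dense with dense preimage
  have hOne : (((U : X.Opens).ι ''ᵁ
      centreCompl ((affineBlowup.idealSheaf I).comap U.2.isoSpec.hom) : X.Opens) :
        Set X).Nonempty := by
    obtain ⟨s, hs⟩ := hWne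
    exact ⟨(U : X.Opens).ι s, s, hs, rfl⟩
  refine ⟨_, (Opens.isOpen _).dense hOne, (π ⁻¹ᵁ _).2.dense ?_, h3⟩
  obtain ⟨o, ho⟩ := hOne
  obtain ⟨y, -⟩ := (Scheme.Hom.homeomorph (π ∣_ ((U : X.Opens).ι ''ᵁ
    centreCompl ((affineBlowup.idealSheaf I).comap U.2.isoSpec.hom)))).surjective ⟨o, ho⟩
  exact ⟨y.1, y.2⟩

/-- Blow-ups at a module transport along isomorphisms of the source. [folklore] -/
theorem iso_comp (h : IsModuleBlowup M r π) {Y' : Scheme.{u}} (f : Y' ≅ Y) :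
    IsModuleBlowup M r (f.hom ≫ π) := by
  refine ⟨fun U _ => ?_⟩
  obtain ⟨φ, hφ, hb⟩ := h.isBlowupAtModule_restrict U
  refine ⟨φ, hφ, ?_⟩
  have h' := hb.iso_comp (asIso (f.hom ∣_ π ⁻¹ᵁ (U : X.Opens)))
  rw [asIso_hom, ← Category.assoc] at h'
  rw [morphismRestrict_comp]
  exact h'

end IsModuleBlowup

end Global

end Literature.AlgebraicGeometry.Resolution

end
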